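/-
Copyright (c) 2026 the pub-hodgecm-mathlib formalisation cell (harness21).  Prover seat hodgecm-mathlib-F0P3a-p04 (g16), 2026-09-01.  Road «S3-tree» (architect A-p16 (g29)),
brick T3′ «depth-zero κ-transfer» (holder F0P3b-p01 (g11)), population (P-2) TYPE (2): organ O8d-alg² — the type-(2) twin of ★ `DepthZeroTransferMatrixIdentity` (O8d-alg).
-/
import Literature.NumberTheory.Rogawski1990.DepthZeroTransferMatrixIdentity            -- ★ O8d-alg (F0P3b-p01 (g11)): the type-(1) identity (shape mirrored here)
import Literature.NumberTheory.Rogawski1990.UnitOrbitalIntegralInertClosedFormsTypeTwo  -- ★ `Flicker1998.phiHtwo` (the printed type-(2) `H`-side closed form)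
import HarnessLib

/-!
# The depth-zero `2×3` matrix (L4) as an identity of κ-sums, TYPE (2): `(−q)^{−n}·(c₀K₀ + c₁(K − K₀ − K₂) + c₂K₂) = a₀·W₂(N−1) + a₁·q^N`

Topic `NumberTheory/Rogawski1990`; namespace `Literature.NumberTheory.Rogawski1990.Flicker1998`.  THEOREMS ONLY (no definition, no instance, no notation, no named fact, no `sorry`);
pure `ℚ`-algebra on the printed closed form `phiHtwo q N = (q^{N+1} − 1)∕(q − 1)` (★ `UnitOrbitalIntegralInertClosedFormsTypeTwo`).  Cell `pub/hodgecm-mathlib`, crux H413 =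
`stmt-HodgeConjecture-24833`; road «S3-tree», brick T3′ (HEAD v4 clause `depthZeroKappaTransfer_hyperspecial_typeTwo`, DESIGN v2 §2 (P-2); census `F0/P3a/F0P3a-p04/g16/CENSUS-T3prime-P2…md`).
HONEST LABEL: HC_CM is proved only modulo the cell's 2 remaining named inputs (hLiu418 24832, h413 24833) until rung 0 closes; this file is elementary algebra and asserts nothing printed.

THE MATHEMATICS.  For a deep `G`-regular `γ_H = (g, u)` of TYPE (2) (`χ_g` irreducible over `L_w`) the observable exponents are `n = ord_w χ_g(u)` (the `G`-depth, ★
`exists_irredExponents_of_hint`: `n = min(2N+1, 2M)`) and `N` (`ord_w disc χ_g = 2N+1`, the `H`-depth); the `G′`-side stable class has TWO classes `c_±` (`κ = ±1`), the `H`-side ONE.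
With the Jordan-strata counts `n_±(r)` (`r = 0, 1, 2` = rank of `γ̄_x − 1` on a fixed hyperspecial vertex `x`) of the two classes and the κ-SUMS `K := Σ_r (n₊(r) − n₋(r))` (unit row),
`K₀ := n₊(0) − n₋(0)` (level-one row), `K₂ := n₊(2) − n₋(2)` (free row), the three ROWS of the type-(2) column are
  `K = (−q)^n · W₂(N)` (★ `flicker_theorem18n`: Flicker's Theorem 18),  `K₀ = (−q)^{n−2} · W₂(N−1)` (the Cayley shift lowers `(n, N)` to `(n−2, N−1)`),
  `K₂ = (−1)^n (q+1) q^{N+n−1}` (the free cyclic `𝒪_w[γ′]`-lattices live on the class of sign `(−1)^n`; census §2 O8a², co-reader's rows q = 3, 5),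
`W₂ := phiHtwo q`.  THEN, for arbitrary stratum values `c₀ c₁ c₂` (the depth-zero piece), with the SAME matrix `M = [[q⁻², 0], [(q²−1)∕q², −1∕q], [0, (q+1)∕q]]` as type (1):
  `(−q)^{−n} · (c₀K₀ + c₁(K − K₀ − K₂) + c₂K₂) = (q⁻²c₀ + ((q²−1)∕q²)c₁) · W₂(N−1) + (−q⁻¹c₁ + ((q+1)∕q)c₂) · (W₂(N) − W₂(N−1))`,
and `W₂(N) − W₂(N−1) = q^N` (`phiHtwo_sub_phiHtwo_pred`) — the right-hand side is `a₀·Φ^st(χ₀)∕ν + a₁·Φ^st(χ₁)∕ν` by ★ T6-2 (`Φ(⟦γ_H⟧, 1_{K_H(1)}) = ν·W₂(N−1)`, `Φ(⟦γ_H⟧, χ₁) = ν·q^N`).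
So the type-(2) population transfers through the SAME two `H`-columns with the SAME coefficients as type (1): the numerics of census «S3» v3 §0 (77∕77 rows, torus types (2)_1, (2)_ν)
as a kernel identity.

* §1 `phiHtwo_sub_phiHtwo_pred` (`W₂(N) − W₂(N−1) = q^N`, `N ≥ 1`).
* §2 **`depthZero_matrix_identity_typeTwo`** (arbitrary `c`), **`depthZero_matrix_identity_typeTwo_rows`** (the three rows `c = e₀, e₁, e₂`).

## References
* [Rogawski1990] J. D. Rogawski, *Automorphic Representations of Unitary Groups in Three Variables* (1990), §4.9 Prop. 4.9.1 (a)(b) p. 55; §8.1 Prop. 8.1.1 p. 112.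
* [Flicker1998UnitaryFL] Y. Z. Flicker, *Elementary proof of the fundamental lemma for a unitary group*, Canad. J. Math. 50 (1998), §6 Thm. 18 p. 97.
-/

set_option autoImplicit false

namespace Literature.NumberTheory.Rogawski1990.Flicker1998

/-! ## §1 The type-(2) `H`-column difference -/

/-- **`W₂(N) − W₂(N−1) = q^N`** for `N ≥ 1` (`W₂ = phiHtwo q`, `phiHtwo q N = (q^{N+1} − 1)∕(q − 1)`). [cite: Flicker1998UnitaryFL, §6 Thm. 18 p. 97] -/
theorem phiHtwo_sub_phiHtwo_pred {q : ℕ} (hq : 1 < q) {N : ℕ} (hN : 1 ≤ N) :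
    phiHtwo q N - phiHtwo q (N - 1) = (q : ℚ) ^ N := by
  obtain ⟨M, rfl⟩ : ∃ M, N = M + 1 := ⟨N - 1, by omega⟩
  have hq1 : (q : ℚ) - 1 ≠ 0 := by
    have h1q : (1 : ℚ) < (q : ℚ) := by exact_mod_cast hq
    exact sub_ne_zero.2 (ne_of_gt h1q)
  rw [Nat.add_sub_cancel, phiHtwo, phiHtwo, pow_succ, pow_succ]
  field_simp
  ring

/-! ## §2 The identity -/

/-- **THE DEPTH-ZERO MATRIX IDENTITY, TYPE (2)** (see the module docstring): from the three κ-sums of the two type-(2) classes to the two `H`-columns, for arbitrary stratum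
values `c₀ c₁ c₂`; deep data (`n ≥ 2`, `N ≥ 1`). [cite: Rogawski1990, §4.9 Prop. 4.9.1 (a) p. 55; §8.1 Prop. 8.1.1 p. 112] [cite: Flicker1998UnitaryFL, §6 Thm. 18 p. 97] -/
theorem depthZero_matrix_identity_typeTwo {q : ℕ} (hq : 1 < q) {n N : ℕ} (hn : 2 ≤ n) (hN : 1 ≤ N) {K₀ K K₂ : ℚ} (c₀ c₁ c₂ : ℚ)
    (hK : K = (-(q : ℚ)) ^ n * phiHtwo q N)
    (hK₀ : K₀ = (-(q : ℚ)) ^ (n - 2) * phiHtwo q (N - 1))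
    (hK₂ : K₂ = (-1 : ℚ) ^ n * ((q : ℚ) + 1) * (q : ℚ) ^ (N + n - 1)) :
    ((-(q : ℚ)) ^ n)⁻¹ * (c₀ * K₀ + c₁ * (K - K₀ - K₂) + c₂ * K₂) =
      (((q : ℚ) ^ 2)⁻¹ * c₀ + (((q : ℚ) ^ 2 - 1) / (q : ℚ) ^ 2) * c₁) * phiHtwo q (N - 1) +
        (-((q : ℚ))⁻¹ * c₁ + (((q : ℚ) + 1) / (q : ℚ)) * c₂) * (phiHtwo q N - phiHtwo q (N - 1)) := by
  have hq0 : (q : ℚ) ≠ 0 := Nat.cast_ne_zero.2 (by omega)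
  obtain ⟨m, rfl⟩ : ∃ m, n = m + 2 := ⟨n - 2, by omega⟩
  obtain ⟨M, rfl⟩ : ∃ M, N = M + 1 := ⟨N - 1, by omega⟩
  have hw := phiHtwo_sub_phiHtwo_pred hq hN
  simp only [Nat.add_sub_cancel] at hw hK₀ ⊢
  rw [show M + 1 + (m + 2) - 1 = M + m + 2 from by omega] at hK₂
  -- `u := (−q)^m`; `(−q)^{m+2} = u q²`; `(−1)^{m+2} q^{M+m+2} = u q^{M+2}`
  set u : ℚ := (-(q : ℚ)) ^ m with hu
  have hu0 : u ≠ 0 := pow_ne_zero _ (neg_ne_zero.2 hq0)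
  have e1 : (-(q : ℚ)) ^ (m + 2) = u * (q : ℚ) ^ 2 := by rw [pow_add, neg_sq]
  have e2 : (-1 : ℚ) ^ (m + 2) * ((q : ℚ) + 1) * (q : ℚ) ^ (M + m + 2) = u * ((q : ℚ) + 1) * (q : ℚ) ^ (M + 2) := by
    rw [hu, neg_pow, pow_add (-1 : ℚ) m 2, show M + m + 2 = m + (M + 2) from by omega, pow_add (q : ℚ) m (M + 2)]; norm_num; ring
  have hW : phiHtwo q (M + 1) = phiHtwo q M + (q : ℚ) ^ (M + 1) := by rw [← hw]; ring
  rw [e1] at hK ⊢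
  rw [e2] at hK₂
  rw [hK, hK₀, hK₂, hW]
  field_simp
  ring

/-- **THE THREE ROWS OF `M = [[q⁻², 0], [(q²−1)∕q², −1∕q], [0, (q+1)∕q]]`, TYPE (2)** (the identity at `c = e₀, e₁, e₂`): `ZK₀ = q⁻²W₂(N−1)`,
`Z(K − K₀ − K₂) = ((q²−1)∕q²)W₂(N−1) − q⁻¹q^N`, `ZK₂ = ((q+1)∕q)q^N`, `Z = (−q)^{−n}`. [cite: Rogawski1990, §4.9 Prop. 4.9.1 (a) p. 55] [cite: Flicker1998UnitaryFL, §6 Thm. 18 p. 97] -/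
theorem depthZero_matrix_identity_typeTwo_rows {q : ℕ} (hq : 1 < q) {n N : ℕ} (hn : 2 ≤ n) (hN : 1 ≤ N) {K₀ K K₂ : ℚ}
    (hK : K = (-(q : ℚ)) ^ n * phiHtwo q N)
    (hK₀ : K₀ = (-(q : ℚ)) ^ (n - 2) * phiHtwo q (N - 1))
    (hK₂ : K₂ = (-1 : ℚ) ^ n * ((q : ℚ) + 1) * (q : ℚ) ^ (N + n - 1)) :
    ((-(q : ℚ)) ^ n)⁻¹ * K₀ = ((q : ℚ) ^ 2)⁻¹ * phiHtwo q (N - 1) ∧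
      ((-(q : ℚ)) ^ n)⁻¹ * (K - K₀ - K₂) =
        (((q : ℚ) ^ 2 - 1) / (q : ℚ) ^ 2) * phiHtwo q (N - 1) - ((q : ℚ))⁻¹ * (phiHtwo q N - phiHtwo q (N - 1)) ∧
      ((-(q : ℚ)) ^ n)⁻¹ * K₂ = (((q : ℚ) + 1) / (q : ℚ)) * (phiHtwo q N - phiHtwo q (N - 1)) := by
  have r0 := depthZero_matrix_identity_typeTwo hq hn hN 1 0 0 hK hK₀ hK₂
  have r1 := depthZero_matrix_identity_typeTwo hq hn hN 0 1 0 hK hK₀ hK₂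
  have r2 := depthZero_matrix_identity_typeTwo hq hn hN 0 0 1 hK hK₀ hK₂
  simp only [one_mul, zero_mul, mul_one, mul_zero, add_zero, zero_add] at r0 r1 r2
  refine ⟨r0, ?_, r2⟩
  rw [r1]
  ring

end Literature.NumberTheory.Rogawski1990.Flicker1998
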